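import Mathlib
import Summits.QuantumAdvantage.QuantumAdvantage.Theorems.MobiusLadderDigitPolyUniformityRigidityGlueWide
import HarnessLib

/-!
# Crux `DigitPolyUniformity` (stmt-QuantumAdvantage-1392), line `Sketch` — cycle 6 (seat c6):
# W from the TWO-FAMILY ×p-rigidity hypothesis (the repair of RigidityWide)

`Theorems/…RigidityGlue` (p138143) proved `W ⇐ Rigidity` with the NARROW test family
`g(N mod 2^k, ⌊N/2^{n−m}⌋)`, `(k+m)^3 ≤ n` (growing bottom depth, top depth `≤ n^{1/3}`), and
`Theorems/…RigidityGlueWide` (p138984) proved `W ⇐ RigidityWide` with the WIDE family `g(N mod 2^{C'}, ⌊N/2^h⌋)`,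
`h₀ ≤ h ≤ n − h₀` (every top depth, FIXED bottom depth `C'`).  Seat c6 refuted RigidityWide
(`Theorems/…RigidityWideFalse`, `Chirp.rigidityWide_false`): the bottom-end 2-adic chirps are polynomial-degree-`O(1)`
near-solutions of the functional equations that are exactly balanced modulo `2^{C'}`.  They ARE caught by the narrow
family (bottom depth `k = K`, a constant).  The natural repair therefore offers the rigidity statement BOTH families:

  RigidityFlex := `∃ C C' η ρ, 0<η ∧ 0<ρ ∧ ∀ A h₀, ∀ᶠ n, ∀ P, deg P ≤ (log₂ n)^A →
     (∀ p prime ≤ C, #{1 ≤ m < 2ⁿ/p : χ_P(pm) = χ_P(m)} ≤ η2ⁿ) →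
       (∃ k m, (k+m)^3 ≤ n ∧ ∃ g 1-bdd, ρ2ⁿ ≤ |Σ χ_P(N) g(N mod 2^k, ⌊N/2^{n−m}⌋)|) ∨
       (∃ h, h₀ ≤ h ∧ h + h₀ ≤ n ∧ ∃ g 1-bdd, ρ2ⁿ ≤ |Σ χ_P(N) g(N mod 2^{C'}, ⌊N/2^h⌋)|)`,

implied by each of Rigidity and RigidityWide (`rigidityFlex_of_rigidity`, `rigidityFlex_of_rigidityWide`), and still
sufficient for W (`inapprox_range_of_rigidity_flex`) and for `L_λ ∉ AC0Mod 2` (`liouvilleNotAC0Xor_of_rigidity_flex`):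
the λ-side spends BOTH unconditional inputs, `stub_ends` (Green's characters mod `2^t`) and the Matomäki–Radziwiłł–Tao
two-ends class at every top depth.  Every KNOWN near-solution (shell characters, Benford chirps of any frequency,
2-adic chirps) is an admissible test of RigidityFlex; what could still refute it is a product of a 2-adic chirp with
a ×p-INVARIANT deep Benford chirp, IF such deep chirps had polylog degree (the standing caveat of the narrow form).
RigidityFlex is a CONJECTURE of this line, never asserted.
-/

noncomputable section

namespace Summit.QuantumAdvantage.DigitPolyUniformity.SketchLAR

open Filter Finset
open Summit.QuantumAdvantage.DigitPolyUniformity.Sketch (stub_ends)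
open RigidityGlue

/-- **RigidityFlex from the narrow Rigidity** (monotonicity: the narrow family is the first disjunct). [folklore] -/
theorem rigidityFlex_of_rigidity
    (hR : ∃ C : ℕ, ∃ η ρ : ℝ, 0 < η ∧ 0 < ρ ∧ ∀ A : ℕ, ∀ᶠ n : ℕ in atTop,
      ∀ P : MvPolynomial (Fin n) (ZMod 2), P.totalDegree ≤ Nat.log 2 n ^ A →
        (∀ p : ℕ, p.Prime → p ≤ C →
          ((((Ico 1 (2 ^ n / p)).filter fun m =>
              (if MvPolynomial.eval (fun i : Fin n => if Nat.testBit (p * m) i then (1 : ZMod 2) else 0) P = 1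
                then (-1 : ℝ) else 1) =
              (if MvPolynomial.eval (fun i : Fin n => if Nat.testBit m i then (1 : ZMod 2) else 0) P = 1
                then (-1 : ℝ) else 1)).card : ℕ) : ℝ) ≤ η * 2 ^ n) →
        ∃ k m : ℕ, (k + m) ^ 3 ≤ n ∧ ∃ g : ℕ → ℕ → ℝ, (∀ a b, |g a b| ≤ 1) ∧
          ρ * 2 ^ n ≤ |∑ N ∈ range (2 ^ n),
            (if MvPolynomial.eval (fun i : Fin n => if Nat.testBit N i then (1 : ZMod 2) else 0) P = 1
              then (-1 : ℝ) else 1) * g (N % 2 ^ k) (N / 2 ^ (n - m))|) (C' : ℕ) :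
    ∃ C C' : ℕ, ∃ η ρ : ℝ, 0 < η ∧ 0 < ρ ∧ ∀ A h₀ : ℕ, ∀ᶠ n : ℕ in atTop,
      ∀ P : MvPolynomial (Fin n) (ZMod 2), P.totalDegree ≤ Nat.log 2 n ^ A →
        (∀ p : ℕ, p.Prime → p ≤ C →
          ((((Ico 1 (2 ^ n / p)).filter fun m =>
              (if MvPolynomial.eval (fun i : Fin n => if Nat.testBit (p * m) i then (1 : ZMod 2) else 0) P = 1
                then (-1 : ℝ) else 1) =
              (if MvPolynomial.eval (fun i : Fin n => if Nat.testBit m i then (1 : ZMod 2) else 0) P = 1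
                then (-1 : ℝ) else 1)).card : ℕ) : ℝ) ≤ η * 2 ^ n) →
        (∃ k m : ℕ, (k + m) ^ 3 ≤ n ∧ ∃ g : ℕ → ℕ → ℝ, (∀ a b, |g a b| ≤ 1) ∧
          ρ * 2 ^ n ≤ |∑ N ∈ range (2 ^ n),
            (if MvPolynomial.eval (fun i : Fin n => if Nat.testBit N i then (1 : ZMod 2) else 0) P = 1
              then (-1 : ℝ) else 1) * g (N % 2 ^ k) (N / 2 ^ (n - m))|) ∨
        (∃ h : ℕ, h₀ ≤ h ∧ h + h₀ ≤ n ∧ ∃ g : ℕ → ℕ → ℝ, (∀ a b, |g a b| ≤ 1) ∧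
          ρ * 2 ^ n ≤ |∑ N ∈ range (2 ^ n),
            (if MvPolynomial.eval (fun i : Fin n => if Nat.testBit N i then (1 : ZMod 2) else 0) P = 1
              then (-1 : ℝ) else 1) * g (N % 2 ^ C') (N / 2 ^ h)|) := by
  obtain ⟨C, η, ρ, hη, hρ, hR⟩ := hR
  refine ⟨C, C', η, ρ, hη, hρ, fun A h₀ => ?_⟩
  filter_upwards [hR A] with n hn P hP hdef
  exact Or.inl (hn P hP hdef)

/-- **RigidityFlex from RigidityWide** (monotonicity: the wide family is the second disjunct; recorded for the
record — RigidityWide itself is false, `Chirp.rigidityWide_false`). [folklore] -/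
theorem rigidityFlex_of_rigidityWide
    (hR : ∃ C C' : ℕ, ∃ η ρ : ℝ, 0 < η ∧ 0 < ρ ∧ ∀ A h₀ : ℕ, ∀ᶠ n : ℕ in atTop,
      ∀ P : MvPolynomial (Fin n) (ZMod 2), P.totalDegree ≤ Nat.log 2 n ^ A →
        (∀ p : ℕ, p.Prime → p ≤ C →
          ((((Ico 1 (2 ^ n / p)).filter fun m =>
              (if MvPolynomial.eval (fun i : Fin n => if Nat.testBit (p * m) i then (1 : ZMod 2) else 0) P = 1
                then (-1 : ℝ) else 1) =
              (if MvPolynomial.eval (fun i : Fin n => if Nat.testBit m i then (1 : ZMod 2) else 0) P = 1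
                then (-1 : ℝ) else 1)).card : ℕ) : ℝ) ≤ η * 2 ^ n) →
        ∃ h : ℕ, h₀ ≤ h ∧ h + h₀ ≤ n ∧ ∃ g : ℕ → ℕ → ℝ, (∀ a b, |g a b| ≤ 1) ∧
          ρ * 2 ^ n ≤ |∑ N ∈ range (2 ^ n),
            (if MvPolynomial.eval (fun i : Fin n => if Nat.testBit N i then (1 : ZMod 2) else 0) P = 1
              then (-1 : ℝ) else 1) * g (N % 2 ^ C') (N / 2 ^ h)|) :
    ∃ C C' : ℕ, ∃ η ρ : ℝ, 0 < η ∧ 0 < ρ ∧ ∀ A h₀ : ℕ, ∀ᶠ n : ℕ in atTop,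
      ∀ P : MvPolynomial (Fin n) (ZMod 2), P.totalDegree ≤ Nat.log 2 n ^ A →
        (∀ p : ℕ, p.Prime → p ≤ C →
          ((((Ico 1 (2 ^ n / p)).filter fun m =>
              (if MvPolynomial.eval (fun i : Fin n => if Nat.testBit (p * m) i then (1 : ZMod 2) else 0) P = 1
                then (-1 : ℝ) else 1) =
              (if MvPolynomial.eval (fun i : Fin n => if Nat.testBit m i then (1 : ZMod 2) else 0) P = 1
                then (-1 : ℝ) else 1)).card : ℕ) : ℝ) ≤ η * 2 ^ n) →
        (∃ k m : ℕ, (k + m) ^ 3 ≤ n ∧ ∃ g : ℕ → ℕ → ℝ, (∀ a b, |g a b| ≤ 1) ∧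
          ρ * 2 ^ n ≤ |∑ N ∈ range (2 ^ n),
            (if MvPolynomial.eval (fun i : Fin n => if Nat.testBit N i then (1 : ZMod 2) else 0) P = 1
              then (-1 : ℝ) else 1) * g (N % 2 ^ k) (N / 2 ^ (n - m))|) ∨
        (∃ h : ℕ, h₀ ≤ h ∧ h + h₀ ≤ n ∧ ∃ g : ℕ → ℕ → ℝ, (∀ a b, |g a b| ≤ 1) ∧
          ρ * 2 ^ n ≤ |∑ N ∈ range (2 ^ n),
            (if MvPolynomial.eval (fun i : Fin n => if Nat.testBit N i then (1 : ZMod 2) else 0) P = 1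
              then (-1 : ℝ) else 1) * g (N % 2 ^ C') (N / 2 ^ h)|) := by
  obtain ⟨C, C', η, ρ, hη, hρ, hR⟩ := hR
  refine ⟨C, C', η, ρ, hη, hρ, fun A h₀ => ?_⟩
  filter_upwards [hR A h₀] with n hn P hP hdef
  exact Or.inr (hn P hP hdef)

/-- **The weak target W from TWO-FAMILY ×p-rigidity.** If polylog-degree digital phases with small ×p-defects for
all primes `p ≤ C` correlate EITHER with an ends test `g(N mod 2^k, ⌊N/2^{n−m}⌋)`, `(k+m)^3 ≤ n`, OR with a two-ends
test `g(N mod 2^{C'}, ⌊N/2^h⌋)` at a depth `h₀ ≤ h ≤ n − h₀` of the λ-side's choosing (hypothesis `hR`,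
RigidityFlex — λ-free, never asserted), then for some `c > 0`, for every `A`, eventually no `P` of degree
`≤ (log₂ n)^A` has `Σ_{N<2ⁿ} λ χ_P > (1 − c)2ⁿ`.  Proof as `inapprox_range_of_rigidity` /
`inapprox_range_of_rigidity_wide`, spending both λ-inputs: `stub_ends` (Green) and
`liouville_twoEnds_weight_le_wide_real` (Matomäki–Radziwiłł–Tao).
[cite: Green2012, Theorem 3 and §1 (remark on the Liouville function)] [cite: MatomakiRadziwillTao2015, Theorem 1.3] -/
theorem inapprox_range_of_rigidity_flex
    (hR : ∃ C C' : ℕ, ∃ η ρ : ℝ, 0 < η ∧ 0 < ρ ∧ ∀ A h₀ : ℕ, ∀ᶠ n : ℕ in atTop,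
      ∀ P : MvPolynomial (Fin n) (ZMod 2), P.totalDegree ≤ Nat.log 2 n ^ A →
        (∀ p : ℕ, p.Prime → p ≤ C →
          ((((Ico 1 (2 ^ n / p)).filter fun m =>
              (if MvPolynomial.eval (fun i : Fin n => if Nat.testBit (p * m) i then (1 : ZMod 2) else 0) P = 1
                then (-1 : ℝ) else 1) =
              (if MvPolynomial.eval (fun i : Fin n => if Nat.testBit m i then (1 : ZMod 2) else 0) P = 1
                then (-1 : ℝ) else 1)).card : ℕ) : ℝ) ≤ η * 2 ^ n) →
        (∃ k m : ℕ, (k + m) ^ 3 ≤ n ∧ ∃ g : ℕ → ℕ → ℝ, (∀ a b, |g a b| ≤ 1) ∧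
          ρ * 2 ^ n ≤ |∑ N ∈ range (2 ^ n),
            (if MvPolynomial.eval (fun i : Fin n => if Nat.testBit N i then (1 : ZMod 2) else 0) P = 1
              then (-1 : ℝ) else 1) * g (N % 2 ^ k) (N / 2 ^ (n - m))|) ∨
        (∃ h : ℕ, h₀ ≤ h ∧ h + h₀ ≤ n ∧ ∃ g : ℕ → ℕ → ℝ, (∀ a b, |g a b| ≤ 1) ∧
          ρ * 2 ^ n ≤ |∑ N ∈ range (2 ^ n),
            (if MvPolynomial.eval (fun i : Fin n => if Nat.testBit N i then (1 : ZMod 2) else 0) P = 1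
              then (-1 : ℝ) else 1) * g (N % 2 ^ C') (N / 2 ^ h)|)) :
    ∃ c : ℝ, 0 < c ∧ ∀ A : ℕ, ∀ᶠ n : ℕ in atTop, ∀ P : MvPolynomial (Fin n) (ZMod 2),
        P.totalDegree ≤ Nat.log 2 n ^ A →
          ∑ N ∈ Finset.range (2 ^ n), ((ArithmeticFunction.liouville N : ℤ) : ℝ) *
              (if MvPolynomial.eval (fun i : Fin n => if Nat.testBit N i then (1 : ZMod 2) else 0) P = 1
                then (-1 : ℝ) else 1) ≤ (1 - c) * (2 : ℝ) ^ n := by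
  obtain ⟨C, C', η, ρ, hη, hρ, hR⟩ := hR
  refine ⟨min η (ρ / 4), lt_min hη (by positivity), fun A => ?_⟩
  have hends := stub_ends (ρ / 4) (by positivity)
  obtain ⟨h₀, hwide⟩ := liouville_twoEnds_weight_le_wide_real C' (ρ / 4) (by positivity)
  have hbig : ∀ᶠ n : ℕ in atTop, 2 / ρ ≤ (2 : ℝ) ^ n := by
    refine (Filter.eventually_ge_atTop ⌈2 / ρ⌉₊).mono fun n hn => ?_
    have h1 : (2 / ρ : ℝ) ≤ n := (Nat.le_ceil _).trans (by exact_mod_cast hn)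
    have h2 : (n : ℝ) ≤ (2 : ℝ) ^ n := by exact_mod_cast Nat.lt_two_pow_self.le
    linarith
  filter_upwards [hR A h₀, hends, hwide, hbig] with n hRn hEn hWn hbn P hP
  set φ : ℕ → ℝ := fun N =>
    (if MvPolynomial.eval (fun i : Fin n => if Nat.testBit N i then (1 : ZMod 2) else 0) P = 1
      then (-1 : ℝ) else 1) with hφdef
  set lam : ℕ → ℝ := fun N => ((ArithmeticFunction.liouville N : ℤ) : ℝ) with hlamdef
  have hφ : ∀ N, φ N = 1 ∨ φ N = -1 := fun N => by
    simp only [hφdef]; split_ifs <;> simp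
  have hlam0 : lam 0 = 0 := by simp [hlamdef]
  have hlam : ∀ N ∈ Ico 1 (2 ^ n), lam N = 1 ∨ lam N = -1 := fun N hN =>
    liouville_real_eq_or (by have := (Finset.mem_Ico.1 hN).1; omega)
  have hX : 1 ≤ 2 ^ n := Nat.one_le_two_pow
  show ∑ N ∈ range (2 ^ n), lam N * φ N ≤ (1 - min η (ρ / 4)) * 2 ^ n
  by_contra hcon
  rw [not_le] at hcon
  set E : Finset ℕ := (Ico 1 (2 ^ n)).filter fun N => φ N ≠ lam N with hEdef
  have hcount := sum_eq_card hX hlam0 hlam hφ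
  rw [hcount] at hcon
  have hc1 : min η (ρ / 4) ≤ η := min_le_left _ _
  have hc2 : min η (ρ / 4) ≤ ρ / 4 := min_le_right _ _
  have h2n : (0 : ℝ) < 2 ^ n := by positivity
  have hE : 2 * (E.card : ℝ) < min η (ρ / 4) * 2 ^ n := by
    rw [hEdef]; push_cast at hcon; linarith
  -- the defects are small
  have hdef : ∀ p : ℕ, p.Prime → p ≤ C →
      ((((Ico 1 (2 ^ n / p)).filter fun m => φ (p * m) = φ m).card : ℕ) : ℝ) ≤ η * 2 ^ n := by
    intro p hp _
    have hle := defect_le (M := 2 ^ n / p) hp.ne_zero φ E (fun m hm hmE hpmE => ?_)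
    · have : (((Ico 1 (2 ^ n / p)).filter fun m => φ (p * m) = φ m).card : ℝ) ≤ 2 * E.card := by
        exact_mod_cast hle
      nlinarith
    · have hm1 : 1 ≤ m := (Finset.mem_Ico.1 hm).1
      have hmM : m < 2 ^ n / p := (Finset.mem_Ico.1 hm).2
      have hpm : p * m < 2 ^ n := by
        have := Nat.div_mul_le_self (2 ^ n) p
        have h' : p * m < p * (2 ^ n / p) := Nat.mul_lt_mul_of_pos_left hmM hp.pos
        rw [mul_comm p (2 ^ n / p)] at h'
        omega
      have hmle : m ≤ p * m := Nat.le_mul_of_pos_left m hp.pos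
      have hmI : m ∈ Ico 1 (2 ^ n) := Finset.mem_Ico.2 ⟨hm1, by omega⟩
      have hpmI : p * m ∈ Ico 1 (2 ^ n) := Finset.mem_Ico.2 ⟨by omega, hpm⟩
      have hφm : φ m = lam m := by
        by_contra hne; exact hmE (Finset.mem_filter.2 ⟨hmI, hne⟩)
      have hφpm : φ (p * m) = lam (p * m) := by
        by_contra hne; exact hpmE (Finset.mem_filter.2 ⟨hpmI, hne⟩)
      have hlampm : lam (p * m) = -lam m := by
        simp only [hlamdef]
        rw [liouville_prime_mul hp (by omega)]
        push_cast; ring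
      rw [hφpm, hφm, hlampm]
      rcases hlam m hmI with h | h <;> rw [h] <;> norm_num
  -- rigidity gives a correlating test from ONE of the two families; λ is orthogonal to both
  have hkey : ∃ G : ℕ → ℝ, (∀ N, |G N| ≤ 1) ∧ ρ * 2 ^ n ≤ |∑ N ∈ range (2 ^ n), φ N * G N| ∧
      |∑ N ∈ range (2 ^ n), lam N * G N| ≤ ρ / 4 * 2 ^ n := by
    rcases hRn P hP hdef with ⟨k, m, hkm, g, hg, hcorr⟩ | ⟨h, hh0h, hhn, g, hg, hcorr⟩
    · exact ⟨fun N => g (N % 2 ^ k) (N / 2 ^ (n - m)), fun N => hg _ _, hcorr, hEn k m hkm g hg⟩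
    · exact ⟨fun N => g (N % 2 ^ C') (N / 2 ^ h), fun N => hg _ _, hcorr, hWn h hh0h hhn g hg⟩
  obtain ⟨G, hG, hcorr, horth⟩ := hkey
  have htrans := corr_transfer hX hlam0 hlam hφ (G := G) hG
  have hρ2 : ρ * 2 ^ n < ρ / 2 * 2 ^ n + 1 := by
    calc ρ * 2 ^ n ≤ |∑ N ∈ range (2 ^ n), φ N * G N| := hcorr
      _ ≤ |∑ N ∈ range (2 ^ n), lam N * G N| + 1 + 2 * (E.card : ℝ) := htrans
      _ < ρ / 4 * 2 ^ n + 1 + ρ / 4 * 2 ^ n := by nlinarith [horth]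
      _ = ρ / 2 * 2 ^ n + 1 := by ring
  have : ρ / 2 * 2 ^ n < 1 := by linarith
  rw [div_le_iff₀ hρ] at hbn
  nlinarith

/-- **The `AC⁰[⊕]` rung from TWO-FAMILY ×p-rigidity** — composition with the landed weak glue (p135858).
[cite: Razborov1987] [cite: Smolensky1987] -/
theorem liouvilleNotAC0Xor_of_rigidity_flex
    (hR : ∃ C C' : ℕ, ∃ η ρ : ℝ, 0 < η ∧ 0 < ρ ∧ ∀ A h₀ : ℕ, ∀ᶠ n : ℕ in atTop,
      ∀ P : MvPolynomial (Fin n) (ZMod 2), P.totalDegree ≤ Nat.log 2 n ^ A →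
        (∀ p : ℕ, p.Prime → p ≤ C →
          ((((Ico 1 (2 ^ n / p)).filter fun m =>
              (if MvPolynomial.eval (fun i : Fin n => if Nat.testBit (p * m) i then (1 : ZMod 2) else 0) P = 1
                then (-1 : ℝ) else 1) =
              (if MvPolynomial.eval (fun i : Fin n => if Nat.testBit m i then (1 : ZMod 2) else 0) P = 1
                then (-1 : ℝ) else 1)).card : ℕ) : ℝ) ≤ η * 2 ^ n) →
        (∃ k m : ℕ, (k + m) ^ 3 ≤ n ∧ ∃ g : ℕ → ℕ → ℝ, (∀ a b, |g a b| ≤ 1) ∧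
          ρ * 2 ^ n ≤ |∑ N ∈ range (2 ^ n),
            (if MvPolynomial.eval (fun i : Fin n => if Nat.testBit N i then (1 : ZMod 2) else 0) P = 1
              then (-1 : ℝ) else 1) * g (N % 2 ^ k) (N / 2 ^ (n - m))|) ∨
        (∃ h : ℕ, h₀ ≤ h ∧ h + h₀ ≤ n ∧ ∃ g : ℕ → ℕ → ℝ, (∀ a b, |g a b| ≤ 1) ∧
          ρ * 2 ^ n ≤ |∑ N ∈ range (2 ^ n),
            (if MvPolynomial.eval (fun i : Fin n => if Nat.testBit N i then (1 : ZMod 2) else 0) P = 1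
              then (-1 : ℝ) else 1) * g (N % 2 ^ C') (N / 2 ^ h)|)) :
    Computability.encodingNatBool.toLanguage {N : ℕ | ArithmeticFunction.liouville N = -1} ∉
      Literature.Computability.Complexity.AC0Mod 2 :=
  liouvilleNotAC0Xor_of_inapprox_range (inapprox_range_of_rigidity_flex hR)

end Summit.QuantumAdvantage.DigitPolyUniformity.SketchLAR

end
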